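/-
Copyright (c) 2026. All rights reserved.
Released under Apache 2.0 license as described in the file LICENSE.
-/
import Summits.AtomisticToContinuum.Crystallization.Theorems.ChartedZeroExcessLayeredLatticeLiouvilleVW

/-!
# ChartedZeroExcessLayeredLatticeLiouville — part VX «ModeIncrements»: THE MODE DICTIONARY APPLIED — every `ϱ`-truncated mode is a mode field
  `(g, cf)` whose layer increments are controlled, uniformly in `ϱ`, by its SLOPE and its (conserved) COLUMN FLUX
  (decomp-a2c-lens-2, g58; first half of brick (4b) MODE RIGIDITY of stmt-AtomisticToContinuum-26636, leaf (LD′) `ModalLipschitzZ`)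

* VX.1 `columnFlux_sub_eq_truncResidual` — the converse bookkeeping of VT: `columnFlux m − columnFlux (m−1)` IS the truncated residual at layer
  `m`; hence a truncated-HARMONIC mode field has a CONSERVED column flux (`columnFlux_const_of_harmonic`).
* VX.2 `columnFlux_sub_columnFlux` — linearity: the difference of the column fluxes of `(g, cf)` and `(g, cf')` is the column flux of `(0, cf − cf')`.
* VX.3 modes are mode fields: `IsAffine M ⟹ M = modeField g cf` (`exists_eq_modeField`); `IsIdxLipschitz` ⟹ chain-Lipschitz / bounded increments.
* VX.4 ★★ `mode_increment_le` — UNIQUENESS MEETS EXISTENCE: a truncated-harmonic mode field `(g, cf)` with bounded increments has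
  `‖cf (α+1) − cf α‖ ≤ modeConst c (κ₀ − ε/2) · (‖F‖ + 441·kernelConst c·(‖g 0‖ + ‖g 1‖))` for EVERY `α`, `F` its conserved column flux:
  subtract VV's extracted profile for the same `(g, F)`; the difference has zero slope, zero flux and bounded increments, so VW's
  `flux_injective` makes its increments vanish.  `truncMode_increment_le` packages it for `IsTruncMode`.
* VX.5 `def ModeIncrementShape` — the (4b.i) statement shape with a `ϱ`-UNIFORM constant — and ★★ `modeIncrementShape_holds`.
-/

namespace Summit.AtomisticToContinuum.Crystallization.Theorems.ChartedZeroExcessLayeredLatticeLiouville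

open Summit.AtomisticToContinuum.Crystallization.Theorems.ChartedPlanarOrderRigidityDoor (E3)
open Finset
open scoped InnerProductSpace RealInnerProductSpace BigOperators

noncomputable section ModeIncrements

variable {c : ℝ} {a b : E3} {w : ℤ → E3}

/-! ### VX.1  Harmonic mode fields have a conserved column flux -/

/-- the jump of the column flux across layer `m` IS the truncated residual of the mode field at `(0, m)` (VT `truncResidual_modeField_eq`,
`sum_chainK_eq_chainFlux_sub`, `sum_slopeK_eq_boxSlope_sub`, VP `chainFlux_eq_box`). [formal bookkeeping] -/
theorem columnFlux_sub_eq_truncResidual (hc : 0 < c) (hL : IsLayeredCrystal c a b w) (ϱ : ℝ) (g : Fin 2 → E3) (cf : ℤ → E3) (m : ℤ) :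
    columnFlux ϱ a b w ⌊ϱ / c⌋₊ g cf m - columnFlux ϱ a b w ⌊ϱ / c⌋₊ g cf (m - 1) = truncResidual ϱ a b w (modeField g cf) ((0 : Cell 2), m) := by
  have hm : m ∈ Icc (m - 1 - ⌊ϱ / c⌋₊) (m + 1 + ⌊ϱ / c⌋₊) := by
    rw [mem_Icc]
    omega
  have hW : layerWindow hc hL ϱ ((0 : Cell 2), m) ⊆ Icc (m - 1 - ⌊ϱ / c⌋₊) (m + 1 + ⌊ϱ / c⌋₊) :=
    (layerWindow_subset_Icc hc hL ϱ m).trans fun k hk => by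
      rw [mem_Icc] at hk ⊢
      omega
  have h1 : Icc (m - ⌊ϱ / c⌋₊) (m + 1 + ⌊ϱ / c⌋₊) ⊆ Icc (m - 1 - ⌊ϱ / c⌋₊) (m + 1 + ⌊ϱ / c⌋₊) := fun k hk => by
    rw [mem_Icc] at hk ⊢
    omega
  have h2 : Icc (m - 1 - ⌊ϱ / c⌋₊) (m - 1 + 1 + ⌊ϱ / c⌋₊) ⊆ Icc (m - 1 - ⌊ϱ / c⌋₊) (m + 1 + ⌊ϱ / c⌋₊) := fun k hk => by
    rw [mem_Icc] at hk ⊢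
    omega
  rw [truncResidual_modeField_eq hc hL ϱ g cf hW, sum_chainK_eq_chainFlux_sub hc hL ϱ cf hm, sum_slopeK_eq_boxSlope_sub hc hL g hm (Subset.refl _),
    columnFlux_eq, columnFlux_eq, chainFlux_eq_box hc hL cf h1, chainFlux_eq_box hc hL cf h2]
  abel

/-- ★ a truncated-HARMONIC mode field has a CONSERVED column flux. [this file, g58] -/
theorem columnFlux_const_of_harmonic (hc : 0 < c) (hL : IsLayeredCrystal c a b w) (ϱ : ℝ) (g : Fin 2 → E3) (cf : ℤ → E3)
    (hH : IsTruncHarmonicZ ϱ a b w (modeField g cf) Set.univ) (m : ℤ) :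
    columnFlux ϱ a b w ⌊ϱ / c⌋₊ g cf m = columnFlux ϱ a b w ⌊ϱ / c⌋₊ g cf 0 := by
  have step : ∀ k : ℤ, columnFlux ϱ a b w ⌊ϱ / c⌋₊ g cf k = columnFlux ϱ a b w ⌊ϱ / c⌋₊ g cf (k - 1) := fun k =>
    sub_eq_zero.mp (by
      rw [columnFlux_sub_eq_truncResidual hc hL ϱ g cf k]
      exact truncResidual_eq_zero_of_isTruncHarmonicZ hH (Set.mem_univ _))
  induction m using Int.induction_on with
  | zero => rfl
  | succ k ih =>
      rw [step ((k : ℤ) + 1), add_sub_cancel_right]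
      exact ih
  | pred k ih =>
      rw [← step (-(k : ℤ))]
      exact ih

/-! ### VX.2  Linearity of the column flux in the profile -/

/-- the column flux is affine in the profile: `columnFlux g cf − columnFlux g cf' = columnFlux 0 (cf − cf')` (VI `chainK_sub`, VW `slopeK_zero`).
[formal bookkeeping] -/
theorem columnFlux_sub_columnFlux (hc : 0 < c) (hL : IsLayeredCrystal c a b w) (ϱ : ℝ) (r : ℕ) (g : Fin 2 → E3) (cf cf' : ℤ → E3) (m : ℤ) :
    columnFlux ϱ a b w r g cf m - columnFlux ϱ a b w r g cf' m = columnFlux ϱ a b w r 0 (cf - cf') m := by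
  unfold columnFlux
  rw [← sum_sub_distrib]
  refine sum_congr rfl fun α _ => ?_
  rw [← sum_sub_distrib]
  refine sum_congr rfl fun β _ => ?_
  rw [slopeK_zero, add_zero, add_sub_add_right_eq_sub, ← chainK_sub hc hL, Pi.sub_apply, Pi.sub_apply, sub_sub_sub_comm]

/-! ### VX.3  Modes are mode fields with chain-Lipschitz profiles -/

/-- an `IsAffine` field is a mode field `modeField g cf`. [formal bookkeeping] -/
theorem exists_eq_modeField {M : Cell 2 → ℤ → E3} (hA : IsAffine M) : ∃ (g : Fin 2 → E3) (cf : ℤ → E3), M = modeField g cf := by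
  obtain ⟨g, cf, h⟩ := hA
  exact ⟨g, cf, funext fun γ => funext fun α => h γ α⟩

/-- on the zero column a mode field is its profile. [formal bookkeeping] -/
theorem modeField_zero_apply (g : Fin 2 → E3) (cf : ℤ → E3) (α : ℤ) : modeField g cf (0 : Cell 2) α = cf α := by
  simp [modeField]

/-- the index distance between two sites of the zero column is the layer distance. [formal bookkeeping] -/
theorem idxNorm_layer_sub (α β : ℤ) : idxNorm ((((0 : Cell 2), β) : Cell 2 × ℤ) - ((0 : Cell 2), α)) = (β - α).natAbs := by
  unfold idxNorm
  simp

/-- an index-Lipschitz mode field has a CHAIN-LIPSCHITZ profile: `‖cf β − cf α‖ ≤ m·|β − α|`. [formal bookkeeping] -/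
theorem chainLipschitz_of_isIdxLipschitz {m : ℝ} {g : Fin 2 → E3} {cf : ℤ → E3} (h : IsIdxLipschitz m (modeField g cf)) (α β : ℤ) :
    ‖cf β - cf α‖ ≤ m * |(((β - α : ℤ)) : ℝ)| := by
  have h1 := h ((0 : Cell 2), α) ((0 : Cell 2), β)
  rw [modeField_zero_apply, modeField_zero_apply, dist_eq_idxNorm, idxNorm_layer_sub, Nat.cast_natAbs, Int.cast_abs] at h1
  exact h1

/-- … in particular its increments are bounded by `m`. [formal bookkeeping] -/
theorem increment_le_of_isIdxLipschitz {m : ℝ} {g : Fin 2 → E3} {cf : ℤ → E3} (h : IsIdxLipschitz m (modeField g cf)) (α : ℤ) :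
    ‖cf (α + 1) - cf α‖ ≤ m := by
  have h1 := chainLipschitz_of_isIdxLipschitz h α (α + 1)
  rw [add_sub_cancel_left, Int.cast_one, abs_one, mul_one] at h1
  exact h1

/-! ### VX.4  ★★ The increments of a mode are controlled by its slope and its flux -/

/-- ★★ MODE INCREMENTS ARE CONTROLLED BY (SLOPE, FLUX): under the tail certificate (`ε < 2κ₀`), a truncated-harmonic mode field `(g, cf)` with bounded
increments satisfies `‖cf (α+1) − cf α‖ ≤ modeConst c (κ₀ − ε/2) · (‖F‖ + 441·kernelConst c·(‖g 0‖ + ‖g 1‖))` at EVERY layer, `F = columnFlux … 0` its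
conserved flux — VV existence (`mode_extraction`) + VW uniqueness (`flux_injective`) applied to the difference profile.  The a-priori bound `m₀` does
not enter the conclusion. [this file, g58] -/
theorem mode_increment_le (hc : 0 < c) (hL : IsLayeredCrystal c a b w) {κ₀ ε ϱ : ℝ} (hϱ : 0 ≤ ϱ) (hε : ε < 2 * κ₀)
    (hK : CoerciveZ (layeredKernel a b w) κ₀)
    (hT : ∀ φ : Cell 2 → ℤ → E3, HasFiniteSupport φ → Summable (tailFam ϱ a b w φ) ∧ ∑' x, tailFam ϱ a b w φ x ≤ ε * nnFormZ φ)
    (g : Fin 2 → E3) (cf : ℤ → E3) (hH : IsTruncHarmonicZ ϱ a b w (modeField g cf) Set.univ) {m₀ : ℝ}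
    (hm₀ : ∀ α : ℤ, ‖cf (α + 1) - cf α‖ ≤ m₀) (α : ℤ) :
    ‖cf (α + 1) - cf α‖ ≤ modeConst c (κ₀ - ε / 2) * (‖columnFlux ϱ a b w ⌊ϱ / c⌋₊ g cf 0‖ + 441 * kernelConst c * (‖g 0‖ + ‖g 1‖)) := by
  have hF : ∀ m : ℤ, columnFlux ϱ a b w ⌊ϱ / c⌋₊ g cf m = columnFlux ϱ a b w ⌊ϱ / c⌋₊ g cf 0 :=
    columnFlux_const_of_harmonic hc hL ϱ g cf hH
  obtain ⟨cf', -, hF', hinc'⟩ := mode_extraction hc hL hϱ hε hK hT g (columnFlux ϱ a b w ⌊ϱ / c⌋₊ g cf 0)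
  have he0 : ∀ m : ℤ, columnFlux ϱ a b w ⌊ϱ / c⌋₊ 0 (cf - cf') m = 0 := fun m => by
    rw [← columnFlux_sub_columnFlux hc hL, hF m, hF' m, sub_self]
  have hR : ∀ k : ℤ, ‖(cf - cf') (k + 1) - (cf - cf') k‖ ≤
      m₀ + modeConst c (κ₀ - ε / 2) * (‖columnFlux ϱ a b w ⌊ϱ / c⌋₊ g cf 0‖ + 441 * kernelConst c * (‖g 0‖ + ‖g 1‖)) := fun k => by
    rw [Pi.sub_apply, Pi.sub_apply, sub_sub_sub_comm]
    exact (norm_sub_le _ _).trans (add_le_add (hm₀ k) (hinc' k))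
  have h0 := flux_injective hc hL hϱ hε hK hT hR (sum_fluxBlock_eq_zero_of_columnFlux hc hL ϱ (cf - cf') he0) α
  rw [Pi.sub_apply, Pi.sub_apply, sub_sub_sub_comm, sub_eq_zero] at h0
  rw [h0]
  exact hinc' α

/-- ★★ packaged for `IsTruncMode`: every `ϱ`-truncated mode is a mode field `(g, cf)` whose increments are bounded by
`modeConst c (κ₀ − ε/2) · (‖F‖ + 441·kernelConst c·(‖g 0‖ + ‖g 1‖))`, `F` its conserved column flux. [this file, g58] -/
theorem truncMode_increment_le (hc : 0 < c) (hL : IsLayeredCrystal c a b w) {κ₀ ε ϱ : ℝ} (hϱ : 0 ≤ ϱ) (hε : ε < 2 * κ₀)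
    (hK : CoerciveZ (layeredKernel a b w) κ₀)
    (hT : ∀ φ : Cell 2 → ℤ → E3, HasFiniteSupport φ → Summable (tailFam ϱ a b w φ) ∧ ∑' x, tailFam ϱ a b w φ x ≤ ε * nnFormZ φ)
    {M : Cell 2 → ℤ → E3} (hM : IsTruncMode ϱ a b w M) :
    ∃ (g : Fin 2 → E3) (cf : ℤ → E3), M = modeField g cf ∧ (∀ m : ℤ, columnFlux ϱ a b w ⌊ϱ / c⌋₊ g cf m = columnFlux ϱ a b w ⌊ϱ / c⌋₊ g cf 0) ∧
      ∀ α : ℤ, ‖cf (α + 1) - cf α‖ ≤ modeConst c (κ₀ - ε / 2) * (‖columnFlux ϱ a b w ⌊ϱ / c⌋₊ g cf 0‖ + 441 * kernelConst c * (‖g 0‖ + ‖g 1‖)) := by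
  obtain ⟨hA, ⟨m₀, hlip⟩, hH⟩ := hM
  obtain ⟨g, cf, rfl⟩ := exists_eq_modeField hA
  exact ⟨g, cf, rfl, columnFlux_const_of_harmonic hc hL ϱ g cf hH,
    mode_increment_le hc hL hϱ hε hK hT g cf hH (increment_le_of_isIdxLipschitz hlip)⟩

/-! ### VX.5  The statement shape: mode increments -/

/-- (4b.i) MODE INCREMENTS — the statement shape (g58; companion of the g57 shapes `ModeExtractionShape` / `ChainLiouvilleShape`): for every certified
laminate and every range `ϱ ≥ ϱ₁(κ₀, c₀)`, EVERY `ϱ`-truncated mode is a mode field `(g, cf)` with conserved column flux whose layer increments are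
bounded by `C(κ₀, c₀) · (‖g 0‖ + ‖g 1‖ + ‖F‖)` — the constant does NOT depend on `ϱ`. [this file, g58] -/
def ModeIncrementShape : Prop :=
  TailDominationCert → ∀ κ₀ > (0 : ℝ), ∀ c₀ > (0 : ℝ), ∃ C ≥ (1 : ℝ), ∃ ϱ₁ ≥ (1 : ℝ), ∀ ϱ ≥ ϱ₁, ∀ (a b : E3) (w : ℤ → E3),
    IsLayeredCrystal c₀ a b w → CoerciveZ (layeredKernel a b w) κ₀ →
      ∀ M : Cell 2 → ℤ → E3, IsTruncMode ϱ a b w M → ∃ (g : Fin 2 → E3) (cf : ℤ → E3), M = modeField g cf ∧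
        (∀ m : ℤ, columnFlux ϱ a b w ⌊ϱ / c₀⌋₊ g cf m = columnFlux ϱ a b w ⌊ϱ / c₀⌋₊ g cf 0) ∧
        ∀ α : ℤ, ‖cf (α + 1) - cf α‖ ≤ C * (‖g 0‖ + ‖g 1‖ + ‖columnFlux ϱ a b w ⌊ϱ / c₀⌋₊ g cf 0‖)

/-- ★★ (4b.i) MODE INCREMENTS HOLD, with `C(κ₀, c₀) = max 1 (modeConst c₀ (κ₀/2) · max 1 (441·kernelConst c₀))` and `ϱ₁ = max 1 ϱ₀(c₀, κ₀)` (tail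
certificate at `ε = κ₀`). [this file, g58] -/
theorem modeIncrementShape_holds : ModeIncrementShape := by
  intro hTD κ₀ hκ₀ c₀ hc₀
  obtain ⟨ϱ₀, _, hTail⟩ := hTD c₀ hc₀ κ₀ hκ₀
  refine ⟨max 1 (modeConst c₀ (κ₀ - κ₀ / 2) * max 1 (441 * kernelConst c₀)), le_max_left _ _, max 1 ϱ₀, le_max_left _ _, ?_⟩
  intro ϱ hϱ a b w hL hK M hM
  have hϱ0 : 0 ≤ ϱ := zero_le_one.trans ((le_max_left _ _).trans hϱ)
  have hϱ₀ϱ : ϱ₀ ≤ ϱ := (le_max_right _ _).trans hϱ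
  have hε : κ₀ < 2 * κ₀ := by linarith
  have hT : ∀ φ : Cell 2 → ℤ → E3, HasFiniteSupport φ →
      Summable (tailFam ϱ a b w φ) ∧ ∑' x, tailFam ϱ a b w φ x ≤ κ₀ * nnFormZ φ :=
    fun φ hφ => hTail ϱ hϱ₀ϱ a b w hL φ hφ
  obtain ⟨g, cf, hMeq, hcol, hinc⟩ := truncMode_increment_le hc₀ hL hϱ0 hε hK hT hM
  refine ⟨g, cf, hMeq, hcol, fun α => (hinc α).trans ?_⟩
  have hM0 : 0 ≤ modeConst c₀ (κ₀ - κ₀ / 2) := modeConst_nonneg c₀ (by linarith)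
  have hF0 := kernelConst_nonneg hc₀
  have hG : 0 ≤ ‖g 0‖ + ‖g 1‖ := by positivity
  have h1 : ‖columnFlux ϱ a b w ⌊ϱ / c₀⌋₊ g cf 0‖ + 441 * kernelConst c₀ * (‖g 0‖ + ‖g 1‖) ≤
      max 1 (441 * kernelConst c₀) * (‖g 0‖ + ‖g 1‖ + ‖columnFlux ϱ a b w ⌊ϱ / c₀⌋₊ g cf 0‖) := by
    have ha : ‖columnFlux ϱ a b w ⌊ϱ / c₀⌋₊ g cf 0‖ ≤ max 1 (441 * kernelConst c₀) * ‖columnFlux ϱ a b w ⌊ϱ / c₀⌋₊ g cf 0‖ :=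
      le_mul_of_one_le_left (norm_nonneg _) (le_max_left _ _)
    have hb : 441 * kernelConst c₀ * (‖g 0‖ + ‖g 1‖) ≤ max 1 (441 * kernelConst c₀) * (‖g 0‖ + ‖g 1‖) :=
      mul_le_mul_of_nonneg_right (le_max_right _ _) hG
    have hc : max 1 (441 * kernelConst c₀) * (‖g 0‖ + ‖g 1‖ + ‖columnFlux ϱ a b w ⌊ϱ / c₀⌋₊ g cf 0‖) =
        max 1 (441 * kernelConst c₀) * (‖g 0‖ + ‖g 1‖) + max 1 (441 * kernelConst c₀) * ‖columnFlux ϱ a b w ⌊ϱ / c₀⌋₊ g cf 0‖ := by ring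
    linarith
  calc modeConst c₀ (κ₀ - κ₀ / 2) * (‖columnFlux ϱ a b w ⌊ϱ / c₀⌋₊ g cf 0‖ + 441 * kernelConst c₀ * (‖g 0‖ + ‖g 1‖))
      ≤ modeConst c₀ (κ₀ - κ₀ / 2) * (max 1 (441 * kernelConst c₀) * (‖g 0‖ + ‖g 1‖ + ‖columnFlux ϱ a b w ⌊ϱ / c₀⌋₊ g cf 0‖)) :=
        mul_le_mul_of_nonneg_left h1 hM0
    _ = modeConst c₀ (κ₀ - κ₀ / 2) * max 1 (441 * kernelConst c₀) * (‖g 0‖ + ‖g 1‖ + ‖columnFlux ϱ a b w ⌊ϱ / c₀⌋₊ g cf 0‖) := by ring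
    _ ≤ max 1 (modeConst c₀ (κ₀ - κ₀ / 2) * max 1 (441 * kernelConst c₀)) * (‖g 0‖ + ‖g 1‖ + ‖columnFlux ϱ a b w ⌊ϱ / c₀⌋₊ g cf 0‖) :=
        mul_le_mul_of_nonneg_right (le_max_right _ _) (by positivity)

end ModeIncrements

end Summit.AtomisticToContinuum.Crystallization.Theorems.ChartedZeroExcessLayeredLatticeLiouville
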